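import Mathlib
import Literature.Analysis.FunctionSpaces.TorusEnstrophyOrthogonality
import Literature.Analysis.FunctionSpaces.TorusFluidGlueProofs
import Literature.Analysis.FunctionSpaces.TorusCalculusProofs
import Literature.Analysis.FunctionSpaces.TorusConvolution

/-!
# Strain bookkeeping for the truncated-dodger kill (negative side of `KolmogorovFloorEnsembleCeiling`,
# stmt-AnomalousDissipation-14183; also of `KolmogorovFloor`, stmt-14030)

Line lead `prover-line-stmt-AnomalousDissipation-14183-0` (2026-08-16), formalising the paper theorem
`FloorWitnessForcesDodgerRoughness` of the crux card `Cruxes/KolmogorovFloor/Ideas/truncated-euler-k41-hot.md`.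
This file is the torus-calculus half: for a smooth DIVERGENCE-FREE field `W` on `T^d`,

* `sum_integral_partialDeriv_cross_eq_zero` — `∑ᵢⱼ ∫ ∂ᵢWⱼ ∂ⱼWᵢ = 0` (twice by parts: it is `∫ (div W)²`);
* `gradNormSq_le_of_strain_bound` — a **Korn-type bound**: if the quadratic form of `DW` is bounded,
  `|⟪η, DW(x) η⟫| ≤ s` for all `x` and all unit `η`, then `‖∇W‖₂² ≤ 8 d² s²` (the antisymmetric part of
  `DW` is invisible to the quadratic form but costs nothing in `L²` thanks to the first identity);
* `exists_strain_sup_compressive` (`d = 3`) — the sup `s` of `|⟪η, DW(x)η⟫|` over `x` and unit `η` is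
  attained, and at the maximising point some unit direction is compressed at rate `≤ -s/2`
  (trace-free: `∑ₖ ⟪bₖ, DW(x) bₖ⟫ = div W (x) = 0` in any orthonormal basis).

Nothing here asserts a Theses statement.
-/

noncomputable section

open MeasureTheory
open scoped InnerProductSpace

namespace Summit.AnomalousDissipation.AnomalousDissipation.Theorems.KolmogorovFloorEnsembleCeiling.Negative

open Literature.Analysis.FunctionSpaces Literature.Analysis.FunctionSpaces.Torus

section General

variable {d : Type} [Fintype d] [DecidableEq d]

/-- **`∑ᵢⱼ ∫ ∂ᵢWⱼ · ∂ⱼWᵢ = 0` for a smooth divergence-free field** (integrate by parts in `xᵢ`, commute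
the partial derivatives and recognise `∂ⱼ (div W) = 0`). -/
theorem sum_integral_partialDeriv_cross_eq_zero {W : UnitAddTorus d → EuclideanSpace ℝ d}
    (hW : IsSmooth W) (hdiv : IsDivFree W) :
    ∑ j, ∑ i, ∫ x, partialDeriv i W x j * partialDeriv j W x i = 0 := by
  have hW1 : IsContDiff 1 W := hW.isContDiff (by simp)
  have hc : ∀ j, IsSmooth (fun y => W y j) := fun j => hW.apply j
  have h1 : ∀ i j x, partialDeriv i W x j = partialDeriv i (fun y => W y j) x :=
    fun i j x => (partialDeriv_apply_coord hW1 i x j).symm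
  -- integration by parts in `xᵢ`
  have hibp : ∀ i j, ∫ x, partialDeriv i W x j * partialDeriv j W x i =
      -∫ x, W x j * partialDeriv i (partialDeriv j (fun y => W y i)) x := by
    intro i j
    have h := integral_inner_partialDeriv_eq_neg (G := ℝ) (hc j) ((hc i).partialDeriv j) i
    have e1 : (fun x => partialDeriv i W x j * partialDeriv j W x i) =
        fun x => ⟪partialDeriv i (fun y => W y j) x, partialDeriv j (fun y => W y i) x⟫_ℝ := by
      funext x
      rw [h1 i j x, h1 j i x]
      exact mul_comm _ _
    have e2 : (fun x => W x j * partialDeriv i (partialDeriv j (fun y => W y i)) x) =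
        fun x => ⟪W x j, partialDeriv i (partialDeriv j (fun y => W y i)) x⟫_ℝ := by
      funext x
      exact mul_comm _ _
    rw [e1, e2]
    exact h
  -- commute the partial derivatives and sum: `∑ᵢ ∂ᵢ∂ⱼWᵢ = ∂ⱼ div W = 0`
  have hsum : ∀ j x, ∑ i, partialDeriv i (partialDeriv j (fun y => W y i)) x = 0 := by
    intro j x
    have e : ∀ i, partialDeriv i (partialDeriv j (fun y => W y i)) x =
        partialDeriv j (partialDeriv i (fun y => W y i)) x := fun i => partialDeriv_comm (hc i) i j x
    simp_rw [e]
    have hs := partialDeriv_finset_sum (F := ℝ) Finset.univ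
      (f := fun i => partialDeriv i (fun y => W y i))
      (fun i _ => ((hc i).partialDeriv i).isContDiff (by simp)) j x
    rw [← hs]
    have hdiv' : (fun y => ∑ i ∈ Finset.univ, partialDeriv i (fun z => W z i) y) = fun _ => (0 : ℝ) := by
      funext y
      exact hdiv y
    rw [hdiv']
    simp [partialDeriv, Torus.lineDeriv]
  have hint : ∀ i j, Integrable (fun x => W x j * partialDeriv i (partialDeriv j (fun y => W y i)) x) volume := by
    intro i j
    exact ((hc j).continuous.mul (((hc i).partialDeriv j).partialDeriv i).continuous).integrable_unitAddTorus
  calc ∑ j, ∑ i, ∫ x, partialDeriv i W x j * partialDeriv j W x i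
      = ∑ j, ∑ i, -∫ x, W x j * partialDeriv i (partialDeriv j (fun y => W y i)) x := by
        simp_rw [hibp]
    _ = ∑ j, -∫ x, W x j * ∑ i, partialDeriv i (partialDeriv j (fun y => W y i)) x := by
        refine Finset.sum_congr rfl fun j _ => ?_
        rw [Finset.sum_neg_distrib, ← integral_finsetSum _ fun i _ => hint i j]
        congr 1
        refine integral_congr_ae (ae_of_all _ fun x => ?_)
        simp only [Finset.mul_sum]
    _ = 0 := by
        simp [hsum]


omit [DecidableEq d] in
/-- Pointwise algebra: for a real `d × d` array, `∑ᵢⱼ Aᵢⱼ² + ∑ᵢⱼ Aᵢⱼ Aⱼᵢ = ½ ∑ᵢⱼ (Aᵢⱼ + Aⱼᵢ)²`. -/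
theorem sum_sq_add_sum_cross_eq (A : d → d → ℝ) :
    (∑ i, ∑ j, A i j ^ 2) + ∑ i, ∑ j, A i j * A j i = (1 / 2) * ∑ i, ∑ j, (A i j + A j i) ^ 2 := by
  have hcomm : ∑ i, ∑ j, A j i ^ 2 = ∑ i, ∑ j, A i j ^ 2 := Finset.sum_comm
  have hexp : ∑ i, ∑ j, (A i j + A j i) ^ 2 =
      (∑ i, ∑ j, A i j ^ 2) + 2 * (∑ i, ∑ j, A i j * A j i) + ∑ i, ∑ j, A j i ^ 2 := by
    simp_rw [Finset.mul_sum, ← Finset.sum_add_distrib]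
    refine Finset.sum_congr rfl fun i _ => Finset.sum_congr rfl fun j _ => ?_
    ring
  rw [hexp, hcomm]
  ring

omit [DecidableEq d] in
/-- The quadratic form of the torus derivative is homogeneous: a bound on unit vectors gives
`|⟪η, DW(x) η⟫| ≤ s ‖η‖²` for every `η`. -/
theorem abs_inner_fderiv_le_mul_norm_sq {W : UnitAddTorus d → EuclideanSpace ℝ d} {s : ℝ}
    (hs : ∀ (x : UnitAddTorus d) (η : EuclideanSpace ℝ d), ‖η‖ = 1 → |⟪η, Torus.fderiv W x η⟫_ℝ| ≤ s)
    (x : UnitAddTorus d) (η : EuclideanSpace ℝ d) :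
    |⟪η, Torus.fderiv W x η⟫_ℝ| ≤ s * ‖η‖ ^ 2 := by
  by_cases hη : η = 0
  · subst hη
    simp
  · have hn : 0 < ‖η‖ := norm_pos_iff.2 hη
    set ξ : EuclideanSpace ℝ d := ‖η‖⁻¹ • η with hξ
    have hξ1 : ‖ξ‖ = 1 := by
      rw [hξ, norm_smul, norm_inv, norm_norm, inv_mul_cancel₀ hn.ne']
    have hηξ : η = ‖η‖ • ξ := by
      rw [hξ, smul_smul, mul_inv_cancel₀ hn.ne', one_smul]
    have hq : ⟪η, Torus.fderiv W x η⟫_ℝ = ‖η‖ ^ 2 * ⟪ξ, Torus.fderiv W x ξ⟫_ℝ := by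
      conv_lhs => rw [hηξ]
      rw [map_smul, inner_smul_left, inner_smul_right]
      simp only [conj_trivial]
      ring
    rw [hq, abs_mul, abs_of_nonneg (sq_nonneg _), mul_comm]
    exact mul_le_mul_of_nonneg_right (hs x ξ hξ1) (sq_nonneg _)

/-- Entries of the symmetrised derivative are controlled by the quadratic form:
`|(∂ᵢW)ⱼ + (∂ⱼW)ᵢ| ≤ 6 s` whenever `|⟪η, DW(x)η⟫| ≤ s` for unit `η` (test with `eᵢ`, `eⱼ`, `eᵢ + eⱼ`). -/
theorem abs_partialDeriv_add_le {W : UnitAddTorus d → EuclideanSpace ℝ d} (hW : IsContDiff 1 W) {s : ℝ}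
    (hs : ∀ (x : UnitAddTorus d) (η : EuclideanSpace ℝ d), ‖η‖ = 1 → |⟪η, Torus.fderiv W x η⟫_ℝ| ≤ s)
    (x : UnitAddTorus d) (i j : d) :
    |partialDeriv i W x j + partialDeriv j W x i| ≤ 6 * s := by
  have hh := abs_inner_fderiv_le_mul_norm_sq hs x
  set L := Torus.fderiv W x with hL
  have he : ∀ k : d, ‖(EuclideanSpace.single k (1 : ℝ) : EuclideanSpace ℝ d)‖ = 1 := fun k => by simp
  -- the entries as values of the quadratic / bilinear form on basis vectors
  have hentry : ∀ k l : d, ⟪EuclideanSpace.single k (1 : ℝ), L (EuclideanSpace.single l 1)⟫_ℝ =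
      partialDeriv l W x k := by
    intro k l
    rw [EuclideanSpace.inner_single_left, partialDeriv_eq_fderiv_apply hW l x]
    simp [hL]
  have hkk : ∀ k : d, |partialDeriv k W x k| ≤ s := by
    intro k
    have h := hh (EuclideanSpace.single k 1)
    rw [he, one_pow, mul_one, hentry] at h
    exact h
  have hsum : |⟪EuclideanSpace.single i (1 : ℝ) + EuclideanSpace.single j 1,
      L (EuclideanSpace.single i (1 : ℝ) + EuclideanSpace.single j 1)⟫_ℝ| ≤ s * 4 := by
    have h := hh (EuclideanSpace.single i 1 + EuclideanSpace.single j 1)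
    have hn : ‖(EuclideanSpace.single i (1 : ℝ) : EuclideanSpace ℝ d) + EuclideanSpace.single j 1‖ ^ 2 ≤ 4 := by
      have ht := norm_add_le (EuclideanSpace.single i (1 : ℝ) : EuclideanSpace ℝ d) (EuclideanSpace.single j 1)
      rw [he, he] at ht
      nlinarith [norm_nonneg ((EuclideanSpace.single i (1 : ℝ) : EuclideanSpace ℝ d) + EuclideanSpace.single j 1)]
    have hs0 : 0 ≤ s := le_trans (abs_nonneg _) (hkk i)
    exact le_trans h (mul_le_mul_of_nonneg_left hn hs0)
  have hexp : ⟪EuclideanSpace.single i (1 : ℝ) + EuclideanSpace.single j 1,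
      L (EuclideanSpace.single i (1 : ℝ) + EuclideanSpace.single j 1)⟫_ℝ =
      partialDeriv i W x i + partialDeriv j W x i + (partialDeriv i W x j + partialDeriv j W x j) := by
    rw [map_add, inner_add_left, inner_add_right, inner_add_right, hentry, hentry, hentry, hentry]
  rw [hexp] at hsum
  have h1 := hkk i
  have h2 := hkk j
  rw [abs_le] at hsum h1 h2 ⊢
  constructor <;> linarith [hsum.1, hsum.2, h1.1, h1.2, h2.1, h2.2]

/-- **Korn-type bound.** For a smooth divergence-free field `W` on `T^d` whose derivative has quadratic
form bounded by `s` on unit vectors, `‖∇W‖₂² ≤ 18 d² s²`. -/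
theorem gradNormSq_le_of_strain_bound {W : UnitAddTorus d → EuclideanSpace ℝ d}
    (hW : IsSmooth W) (hdiv : IsDivFree W) {s : ℝ}
    (hs : ∀ (x : UnitAddTorus d) (η : EuclideanSpace ℝ d), ‖η‖ = 1 → |⟪η, Torus.fderiv W x η⟫_ℝ| ≤ s) :
    gradNormSq W ≤ 18 * (Fintype.card d : ℝ) ^ 2 * s ^ 2 := by
  have hW1 : IsContDiff 1 W := hW.isContDiff (by simp)
  set A : UnitAddTorus d → d → d → ℝ := fun x i j => partialDeriv i W x j with hA
  -- pointwise: `∑ᵢ ‖∂ᵢW‖² + ∑ᵢⱼ AᵢⱼAⱼᵢ ≤ 18 d² s²`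
  have hpt : ∀ x, (∑ i, ‖partialDeriv i W x‖ ^ 2) + ∑ i, ∑ j, A x i j * A x j i ≤
      18 * (Fintype.card d : ℝ) ^ 2 * s ^ 2 := by
    intro x
    have hnorm : ∑ i, ‖partialDeriv i W x‖ ^ 2 = ∑ i, ∑ j, A x i j ^ 2 := by
      refine Finset.sum_congr rfl fun i _ => ?_
      rw [EuclideanSpace.norm_sq_eq]
      refine Finset.sum_congr rfl fun j _ => ?_
      simp [hA, Real.norm_eq_abs, sq_abs]
    rw [hnorm, sum_sq_add_sum_cross_eq]
    have hb : ∀ i j, (A x i j + A x j i) ^ 2 ≤ (6 * s) ^ 2 := by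
      intro i j
      have h := abs_partialDeriv_add_le hW1 hs x i j
      have h0 : 0 ≤ 6 * s := le_trans (abs_nonneg _) h
      calc (A x i j + A x j i) ^ 2 = |A x i j + A x j i| ^ 2 := (sq_abs _).symm
        _ ≤ (6 * s) ^ 2 := pow_le_pow_left₀ (abs_nonneg _) h 2
    calc (1 / 2 : ℝ) * ∑ i, ∑ j, (A x i j + A x j i) ^ 2
        ≤ (1 / 2 : ℝ) * ∑ _i : d, ∑ _j : d, (6 * s) ^ 2 := by
          refine mul_le_mul_of_nonneg_left ?_ (by norm_num)
          exact Finset.sum_le_sum fun i _ => Finset.sum_le_sum fun j _ => hb i j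
      _ = 18 * (Fintype.card d : ℝ) ^ 2 * s ^ 2 := by
          simp only [Finset.sum_const, Finset.card_univ, nsmul_eq_mul]
          ring
  -- integrate
  have hcont : ∀ i, Continuous (partialDeriv i W) := fun i => (hW.partialDeriv i).continuous
  have hi1 : Integrable (fun x => ∑ i, ‖partialDeriv i W x‖ ^ 2) volume :=
    (continuous_finsetSum _ fun i _ => ((hcont i).norm).pow 2).integrable_unitAddTorus
  have hcA : ∀ i j, Continuous (fun x => A x i j) := by
    intro i j
    simp only [hA]
    exact (EuclideanSpace.proj j).continuous.comp (hcont i)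
  have hi2' : ∀ i j, Integrable (fun x => A x i j * A x j i) volume := fun i j =>
    ((hcA i j).mul (hcA j i)).integrable_unitAddTorus
  have hi2 : Integrable (fun x => ∑ i, ∑ j, A x i j * A x j i) volume :=
    integrable_finsetSum _ fun i _ => integrable_finsetSum _ fun j _ => hi2' i j
  have hcross : ∫ x, ∑ i, ∑ j, A x i j * A x j i = 0 := by
    rw [integral_finsetSum _ fun i _ => integrable_finsetSum _ fun j _ => hi2' i j]
    simp_rw [integral_finsetSum _ fun j _ => hi2' _ j]
    rw [Finset.sum_comm]
    simpa [hA] using sum_integral_partialDeriv_cross_eq_zero hW hdiv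
  have hmono : ∫ x, ((∑ i, ‖partialDeriv i W x‖ ^ 2) + ∑ i, ∑ j, A x i j * A x j i) ≤
      ∫ _x : UnitAddTorus d, 18 * (Fintype.card d : ℝ) ^ 2 * s ^ 2 :=
    integral_mono (hi1.add hi2) (integrable_const _) hpt
  rw [integral_add hi1 hi2, hcross, add_zero, integral_const] at hmono
  simpa [gradNormSq] using hmono

end General

/-! ### The compressive direction (three dimensions) -/

section Three

/-- **Sup of the strain quadratic form and a compressive direction.** For a smooth divergence-free `W`
on `T³` there is `s ≥ 0` bounding `|⟪η, DW(x) η⟫|` over all `x` and unit `η` (the sup, attained by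
compactness), and a point `x₀` with a unit direction `ξ` compressed at rate `⟪ξ, DW(x₀) ξ⟫ ≤ -s/2`
(at the maximiser: if the form is `-s` take that direction; if it is `+s`, complete to an orthonormal
basis — the three diagonal values sum to `div W = 0`, so one of the other two is `≤ -s/2`). -/
theorem exists_strain_sup_compressive {W : (UnitAddTorus (Fin 3)) → (EuclideanSpace ℝ (Fin 3))} (hW : IsSmooth W) (hdiv : IsDivFree W) :
    ∃ s : ℝ, 0 ≤ s ∧ (∀ (x : (UnitAddTorus (Fin 3))) (η : (EuclideanSpace ℝ (Fin 3))), ‖η‖ = 1 → |⟪η, Torus.fderiv W x η⟫_ℝ| ≤ s) ∧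
      ∃ (x₀ : (UnitAddTorus (Fin 3))) (ξ : (EuclideanSpace ℝ (Fin 3))), ‖ξ‖ = 1 ∧ ⟪ξ, Torus.fderiv W x₀ ξ⟫_ℝ ≤ -(s / 2) := by
  have hW1 : IsContDiff 1 W := hW.isContDiff (by simp)
  -- the continuous function `(x, η) ↦ |⟪η, DW(x) η⟫|` on the compact set `T³ × S²`
  set g : (UnitAddTorus (Fin 3)) × (EuclideanSpace ℝ (Fin 3)) → ℝ := fun p => |⟪p.2, Torus.fderiv W p.1 p.2⟫_ℝ| with hg
  have hcont : Continuous g := by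
    have h1 : Continuous fun p : (UnitAddTorus (Fin 3)) × (EuclideanSpace ℝ (Fin 3)) => Torus.fderiv W p.1 :=
      (IsContDiff.continuous_fderiv hW1).comp continuous_fst
    have h2 : Continuous fun p : (UnitAddTorus (Fin 3)) × (EuclideanSpace ℝ (Fin 3)) => Torus.fderiv W p.1 p.2 := h1.clm_apply continuous_snd
    exact (continuous_snd.inner h2).abs
  set K : Set ((UnitAddTorus (Fin 3)) × (EuclideanSpace ℝ (Fin 3))) := (Set.univ : Set (UnitAddTorus (Fin 3))) ×ˢ Metric.sphere (0 : (EuclideanSpace ℝ (Fin 3))) 1 with hK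
  have hKc : IsCompact K := isCompact_univ.prod (isCompact_sphere 0 1)
  have hmem : ∀ (x : (UnitAddTorus (Fin 3))) (η : (EuclideanSpace ℝ (Fin 3))), ‖η‖ = 1 → (x, η) ∈ K := by
    intro x η hη
    refine ⟨Set.mem_univ _, ?_⟩
    simpa using hη
  have he0 : ‖(EuclideanSpace.single (0 : Fin 3) (1 : ℝ) : (EuclideanSpace ℝ (Fin 3)))‖ = 1 := by simp
  have hKn : K.Nonempty := ⟨((0 : (UnitAddTorus (Fin 3))), EuclideanSpace.single 0 1), hmem _ _ he0⟩
  obtain ⟨p₁, hp₁, hmax⟩ := hKc.exists_isMaxOn hKn hcont.continuousOn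
  have hgval : ∀ (x : (UnitAddTorus (Fin 3))) (η : (EuclideanSpace ℝ (Fin 3))), g (x, η) = |⟪η, Torus.fderiv W x η⟫_ℝ| := fun _ _ => rfl
  have hs0 : 0 ≤ g p₁ := by rw [hg]; exact abs_nonneg _
  have hbound : ∀ (x : (UnitAddTorus (Fin 3))) (η : (EuclideanSpace ℝ (Fin 3))), ‖η‖ = 1 → |⟪η, Torus.fderiv W x η⟫_ℝ| ≤ g p₁ := by
    intro x η hη
    rw [← hgval]
    exact hmax (hmem x η hη)
  refine ⟨g p₁, hs0, hbound, ?_⟩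
  -- the maximiser
  obtain ⟨x₁, η₁⟩ := p₁
  have hη₁ : ‖η₁‖ = 1 := by
    have h := hp₁.2
    simpa using h
  obtain ⟨s, hs⟩ : ∃ s : ℝ, g (x₁, η₁) = s := ⟨_, rfl⟩
  rw [hs] at hs0 ⊢
  have hQ₁ : |⟪η₁, Torus.fderiv W x₁ η₁⟫_ℝ| = s := by rw [← hgval, hs]
  by_cases hneg : ⟪η₁, Torus.fderiv W x₁ η₁⟫_ℝ ≤ 0
  · refine ⟨x₁, η₁, hη₁, ?_⟩
    rw [abs_of_nonpos hneg] at hQ₁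
    linarith
  · push Not at hneg
    have hQ₁' : ⟪η₁, Torus.fderiv W x₁ η₁⟫_ℝ = s := by rwa [abs_of_pos hneg] at hQ₁
    -- complete `η₁` to an orthonormal basis
    have hv : Orthonormal ℝ (Subtype.val : ({η₁} : Set (EuclideanSpace ℝ (Fin 3))) → (EuclideanSpace ℝ (Fin 3))) := by
      refine ⟨fun i => ?_, fun i j hij => ?_⟩
      · obtain ⟨i, hi⟩ := i
        rw [Set.mem_singleton_iff] at hi
        simp [hi, hη₁]
      · exfalso
        apply hij
        apply Subtype.ext
        have hi := i.2
        have hj := j.2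
        rw [Set.mem_singleton_iff] at hi hj
        rw [hi, hj]
    obtain ⟨u, b, hsub, hb⟩ := hv.exists_orthonormalBasis_extension
    have hη₁u : η₁ ∈ u := hsub (Set.mem_singleton η₁)
    have hbi₀ : b ⟨η₁, hη₁u⟩ = η₁ := by rw [hb]
    -- trace-free: `∑ᵢ ⟪bᵢ, L bᵢ⟫ = div W (x₁) = 0`
    have htrace : ∑ i, ⟪b i, Torus.fderiv W x₁ (b i)⟫_ℝ = 0 := by
      have h := divergence_eq_trace_fderiv hW1 x₁
      rw [LinearMap.trace_eq_sum_inner _ b, hdiv x₁] at h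
      exact_mod_cast h.symm
    -- cardinality of the index set
    have hcard : Fintype.card u = 3 := by
      have h := Module.finrank_eq_card_basis b.toBasis
      rw [finrank_euclideanSpace_fin] at h
      exact h.symm
    have hcard' : (Finset.univ.erase (⟨η₁, hη₁u⟩ : u)).card = 2 := by
      rw [Finset.card_erase_of_mem (Finset.mem_univ _), Finset.card_univ, hcard]
    have hne : (Finset.univ.erase (⟨η₁, hη₁u⟩ : u)).Nonempty := by
      rw [← Finset.card_pos, hcard']
      norm_num
    have hsum : ∑ i ∈ Finset.univ.erase (⟨η₁, hη₁u⟩ : u), ⟪b i, Torus.fderiv W x₁ (b i)⟫_ℝ = -s := by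
      have h := Finset.sum_erase_add Finset.univ (fun i => ⟪b i, Torus.fderiv W x₁ (b i)⟫_ℝ)
        (Finset.mem_univ (⟨η₁, hη₁u⟩ : u))
      rw [htrace, hbi₀, hQ₁'] at h
      linarith
    have hle : ∑ i ∈ Finset.univ.erase (⟨η₁, hη₁u⟩ : u), ⟪b i, Torus.fderiv W x₁ (b i)⟫_ℝ ≤
        ∑ _i ∈ Finset.univ.erase (⟨η₁, hη₁u⟩ : u), (-(s / 2)) := by
      rw [hsum, Finset.sum_const, hcard', nsmul_eq_mul]
      push_cast
      linarith
    obtain ⟨i, _, hi⟩ := Finset.exists_le_of_sum_le hne hle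
    exact ⟨x₁, b i, b.orthonormal.1 i, hi⟩

end Three

end Summit.AnomalousDissipation.AnomalousDissipation.Theorems.KolmogorovFloorEnsembleCeiling.Negative
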